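import Literature.Computability.QuantumComplexity.BasisMapLocalityOn
import Literature.Computability.QuantumComplexity.GuardedOps
import Literature.Computability.QuantumComplexity.ClEvalFlagFrame
import HarnessLib

/-!
# Label-set-relative locality of (guarded) classical programs, and its composition

Topic `Literature/Computability/QuantumComplexity`; sequel of `BasisMapLocalityOn.lean` (`LocalOn κ T G`),
`GuardedOps.lean` (`guardOps`, `clEval_guardOps_of_not_flag`) and `ClEvalFlagFrame.lean` (`clEval_congr_on`).
The classical routing / copying / erasing stage of a universal machine with `K` slots is the concatenation of
the slots' guarded programs; this file supplies the three facts that make it `LocalOn T G` for the idle set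
`T` (the inactive slots' wires) and the reachable labels `G` (flags consistent, scratch clean):

* `LocalOn.of_eqOn` — a map that is the identity on `G` is local on `G` (an inactive slot's guarded program,
  by `clEval_guardOps_of_not_flag`): `localOn_clEval_guardOps_of_flags_off`;
* `LocalOn.of_wires_off` — a program none of whose wires lies in `T` is local (the active slot's program, or
  any unguarded program on the common area): `localOn_clEval_of_wires_off`;
* **`LocalOn.comp`** — locality composes along maps preserving `G`; `clEval` of a concatenation is the
  composition (`clEval_append`), so the whole stage is local: `localOn_clEval_append`.

Everything is proved; no definition, no named fact is introduced.

## References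

* M. A. Nielsen, I. L. Chuang, *Quantum Computation and Quantum Information*, CUP 2010, §3.2.5, §4.3
  [NielsenChuang2010].
* O. Regev, *On lattices, learning with errors, random linear codes, and cryptography*, J. ACM 56 (2009),
  art. 34, Lemma 3.14 (proof) [Regev2009].
-/

namespace Literature.Computability.QuantumComplexity

open Cryptography

variable {W : ℕ} {T : Finset (Fin W)} {G : Set (QReg W)}

/-- **A map that is the identity on `G` is local on `G`** (for any `T` off which `G` is determined). [folklore] -/
theorem LocalOn.of_eqOn {κ : QReg W → QReg W}
    (hG : ∀ z z' : QReg W, (∀ w, w ∉ T → z w = z' w) → z ∈ G → z' ∈ G) (hκ : ∀ z ∈ G, κ z = z) :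
    LocalOn κ T G where
  offDetermined := hG
  fix z hz w _ := by rw [hκ z hz]
  indep z hz z' hz' h w hw := by rw [hκ z hz, hκ z' hz', h w hw]

/-- **A map that never changes `T` and whose values off `T` ignore `T` is local on every `G` determined off `T`.**
[folklore] -/
theorem LocalOn.of_off {κ : QReg W → QReg W}
    (hG : ∀ z z' : QReg W, (∀ w, w ∉ T → z w = z' w) → z ∈ G → z' ∈ G) (hfix : ∀ z : QReg W, ∀ w ∈ T, κ z w = z w)
    (hind : ∀ z z' : QReg W, (∀ w, w ∉ T → z w = z' w) → ∀ w, w ∉ T → κ z w = κ z' w) : LocalOn κ T G where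
  offDetermined := hG
  fix z _ w hw := hfix z w hw
  indep z _ z' _ h w hw := hind z z' h w hw

/-- **Locality composes** along a first map that preserves `G`. [cite: NielsenChuang2010, §4.3] -/
theorem LocalOn.comp {κ₁ κ₂ : QReg W → QReg W} (h₁ : LocalOn κ₁ T G) (h₂ : LocalOn κ₂ T G)
    (hG₁ : ∀ z ∈ G, κ₁ z ∈ G) : LocalOn (κ₂ ∘ κ₁) T G where
  offDetermined := h₁.offDetermined
  fix z hz w hw := by rw [Function.comp_apply, h₂.fix _ (hG₁ z hz) w hw, h₁.fix z hz w hw]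
  indep z hz z' hz' h w hw := by
    rw [Function.comp_apply, Function.comp_apply]
    exact h₂.indep _ (hG₁ z hz) _ (hG₁ z' hz') (h₁.indep z hz z' hz' h) w hw

/-! ### Instances for straight-line programs -/

/-- **A program none of whose wires lies in `T`** is local on every label set determined off `T`.
[cite: NielsenChuang2010, §3.2.5] -/
theorem localOn_clEval_of_wires_off (ops : List (ClOp (Fin W)))
    (hops : ∀ op ∈ ops, op.target ∉ T ∧ ∀ c ∈ op.controls, c ∉ T)
    (hG : ∀ z z' : QReg W, (∀ w, w ∉ T → z w = z' w) → z ∈ G → z' ∈ G) : LocalOn (clEval ops) T G :=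
  LocalOn.of_off hG
    (fun z _ hw => clEval_apply_of_forall_target_ne ops z fun op hop h => (hops op hop).1 (h ▸ hw))
    (fun _ _ h => clEval_congr_on (S := {w | w ∉ T}) ops (fun op hop c hc => (hops op hop).2 c hc) (fun w hw => h w hw))

/-- **A guarded program whose flag is off (and scratch clean) on `G`** is local on `G`: it is the identity there.
[cite: NielsenChuang2010, §4.3] [cite: Regev2009, Lemma 3.14 (proof)] -/
theorem localOn_clEval_guardOps_of_flags_off (flag s : Fin W) (ops : List (ClOp (Fin W)))
    (hwf : ∀ op ∈ ops, op.WF) (hfr : ∀ op ∈ ops, ClOp.Fresh flag s op)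
    (hG : ∀ z z' : QReg W, (∀ w, w ∉ T → z w = z' w) → z ∈ G → z' ∈ G)
    (hs : ∀ z ∈ G, z s = false) (hfl : ∀ z ∈ G, z flag = false) :
    LocalOn (clEval (guardOps flag s ops)) T G :=
  LocalOn.of_eqOn hG fun z hz => clEval_guardOps_of_not_flag flag s ops hwf hfr z (hs z hz) (hfl z hz)

/-- **A concatenation of programs each local on `G` and preserving `G` is local on `G`.**
[cite: NielsenChuang2010, §4.3] -/
theorem localOn_clEval_append {ops₁ ops₂ : List (ClOp (Fin W))} (h₁ : LocalOn (clEval ops₁) T G)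
    (h₂ : LocalOn (clEval ops₂) T G) (hG₁ : ∀ z ∈ G, clEval ops₁ z ∈ G) :
    LocalOn (clEval (ops₁ ++ ops₂)) T G := by
  have h : clEval (ops₁ ++ ops₂) = clEval ops₂ ∘ clEval ops₁ := funext fun z => clEval_append ops₁ ops₂ z
  rw [h]
  exact h₁.comp h₂ hG₁

end Literature.Computability.QuantumComplexity
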